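/-
Copyright: the b2b-balaban cell (near-miss cell 7), T⁴-continuum fan-out, lineage t4-ne7b-p3 (node U5c LARGE-DEVIATION
member P3).  Released under the licence of the surrounding project.
-/
import Summits.QuantumFields.BalabanUV.T4Continuum.Support.HistoryRealiseTimed
import Summits.QuantumFields.BalabanUV.T4Continuum.Support.HistorySlots

/-!
# Space-time Peierls ∕ Cramér route for NE7b — THE TAGGED LABEL OF A HISTORY: every event its own label, so that
# NO `TypeNodup` is needed (histories with several joins at one step, or several regions of one class born at one step,
# are admitted)

Summits-side support leaf of the T⁴-continuum cell (rung (B)+1 on a FINITE torus only; NOT infinite volume, NOT the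
mass gap, NOT the Clay statement; NOT a proof of the spine estimate NE7b).  Lineage `t4-ne7b-p3` (generation 3), node
U5c, skeleton `t4/skeletons/NE7b-t4-ne7b-p3.md` §14 (the TAGGED road).  [folklore] finite combinatorics over the COUNT
swarm's carriers `HistoryAdmissible.PGen` (p207789), `HistoryRealise.Realises` (p209120), `HistoryRealiseTimed`
(`consistentTLE_gmap_iff`, `consistentTLE_toGen_of_realises`), `HistoryBankingLE.ConsistentTLE`, `LateMergers.FreshT`,
`ZoneSkeleton.gmap` — all BY NAME; nothing printed is asserted; no `[cite:]` tag.

WHY.  The canonical label `PGen.toGen : PGen γ → Gen PEv` names an event by its type `(step, kind, class)`; two events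
of one type (two joins at one step — print binarises a join of `m ≥ 3` constituents into `m − 1` binary joins AT THE
SAME STEP, p. 386; two regions of one class born at one step) COLLIDE, and the COUNT swarm's finding F-ne7bp1g22-1(d)
∕ ruling R-A restrict the flat carrier to `TypeNodup` histories.  Here every event is labelled `(tag, type)` with a
distinct natural-number TAG (pre-order numbering), and every reading of the dictionary is taken through the shape map
`Prod.snd` — the COUNT swarm's own tagged machinery (`ConsistentTLE sh`, `bankedLE_induction` for any `sh`, `FreshT`).

WHAT.
* §1 `evCount`, **`toGenT n P : Gen (ℕ × PEv)`** (tags `n, n+1, …` in pre-order), `gmap_snd_toGenT`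
  (`gmap Prod.snd (toGenT n P) = P.toGen`), `tag_range` (tags of `toGenT n P` lie in `[n, n + evCount P)`),
  **`freshT_toGenT`** (ALWAYS fresh), `rootStep_toGenT`, `reach_toGenT`, `snd_top_toGenT`, `step_le_of_mem_toGenT`.
* §2 timing FROM THE GEOMETRY, no `TypeNodup`, no `RenewAtReach`: **`consistentTLE_toGenT_of_realises`**
  (`Realises → lastStep ≤ K → ConsistentTLE Prod.snd C K R (toGenT n P)`), **`wf_toGenT_of_realises`**
  (`Realises → (toGenT n P).WF (dictWT Prod.snd R n₁)`), `lt_reach_toGenT_of_pendingAt`.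

HONEST DEPENDENCY (cell, verbatim): continuum YM on T⁴ ⇐ BetaPertH ∧ nine spine estimates (0/9 proved); BetaPertH ⇐
(D1) ∧ (D4) ∧ CAP+tail; G-an2-4 gates asym, D1 and NE2/3/4.  This file changes none of it.
-/

open Finset

namespace Summit.QuantumFields.BalabanUV.T4Continuum.SpaceTimePeierls

open Literature.MathematicalPhysics.QuantumFieldTheory.Balaban1983to89
open Literature.MathematicalPhysics.QuantumFieldTheory.Balaban1983to89.B13ScaleTransfer
open Literature.MathematicalPhysics.QuantumFieldTheory.Balaban1983to89.B16SProfile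
open T4PersistenceDictionary T4TaggedShapeBanking
open Summit.QuantumFields.BalabanUV.T4Continuum.ZoneSkeleton (gmap events_gmap reach_gmap rootStep_gmap)
open Summit.QuantumFields.BalabanUV.T4Continuum.HistoryAdmissible
open Summit.QuantumFields.BalabanUV.T4Continuum.HistoryRealise
open Summit.QuantumFields.BalabanUV.T4Continuum.HistoryBankingLE (ConsistentTLE)
open Summit.QuantumFields.BalabanUV.T4Continuum.LateMergers (FreshT)

noncomputable section

/-! ## §1 The tagged label -/

section Tagged

variable {γ : Type*}

/-- the number of events of a history [folklore] -/
def evCount : PGen γ → ℕ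
  | .birth _ _ _ => 1
  | .renew G _ => evCount G + 1
  | .join X Y _ => evCount X + evCount Y + 1

/-- **THE TAGGED LABEL**: the genealogy of the history with every event labelled `(tag, type)`, tags numbered in
pre-order from `n` (the top event carries `n`; the renewed part ∕ the endpoint partner starts at `n + 1`; the rest
partner after the endpoint's block). [folklore] -/
def toGenT : ℕ → PGen γ → Gen (ℕ × PEv)
  | n, .birth j d _ => Gen.born (n, ((j, 0, d) : PEv)) j
  | n, .renew G h => Gen.renew (toGenT (n + 1) G) (n, ((h + 1, 1, 0) : PEv)) h
  | n, .join X Y s => Gen.merge (toGenT (n + 1) X) (toGenT (n + 1 + evCount X) Y) (n, ((s, 2, 0) : PEv))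

/-- **FORGETTING THE TAGS GIVES THE CANONICAL LABEL**: `gmap Prod.snd (toGenT n P) = P.toGen`. [folklore] -/
theorem gmap_snd_toGenT : ∀ (n : ℕ) (P : PGen γ), gmap Prod.snd (toGenT n P) = P.toGen
  | n, .birth j d z => rfl
  | n, .renew G h => by
      simp only [toGenT, gmap, PGen.toGen, gmap_snd_toGenT (n + 1) G]
  | n, .join X Y s => by
      simp only [toGenT, gmap, PGen.toGen, gmap_snd_toGenT (n + 1) X, gmap_snd_toGenT (n + 1 + evCount X) Y]

/-- **THE TAGS OF `toGenT n P` LIE IN `[n, n + evCount P)`.** [folklore] -/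
theorem tag_range : ∀ (n : ℕ) (P : PGen γ), ∀ e ∈ (toGenT n P).events, n ≤ e.1 ∧ e.1 < n + evCount P
  | n, .birth j d z, e, he => by
      simp only [toGenT, Gen.events_born, mem_singleton] at he
      subst he
      simp [evCount]
  | n, .renew G h, e, he => by
      simp only [toGenT, Gen.events_renew, mem_insert] at he
      rcases he with rfl | he
      · simp [evCount]
      · have := tag_range (n + 1) G e he
        simp only [evCount]
        omega
  | n, .join X Y s, e, he => by
      simp only [toGenT, Gen.events_merge, mem_insert, mem_union] at he
      rcases he with rfl | he | he
      · simp [evCount]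
      · have := tag_range (n + 1) X e he
        simp only [evCount]
        omega
      · have := tag_range (n + 1 + evCount X) Y e he
        simp only [evCount]
        omega

/-- **THE TAGGED LABEL IS ALWAYS FRESH** (pairwise distinct labels, partners' label sets disjoint) — no `TypeNodup`.
[folklore] -/
theorem freshT_toGenT : ∀ (n : ℕ) (P : PGen γ), FreshT (toGenT n P)
  | n, .birth j d z => trivial
  | n, .renew G h => by
      refine ⟨freshT_toGenT (n + 1) G, fun hmem => ?_⟩
      have := tag_range (n + 1) G _ hmem
      simp at this
  | n, .join X Y s => by
      refine ⟨freshT_toGenT (n + 1) X, freshT_toGenT (n + 1 + evCount X) Y, fun hmem => ?_, fun hmem => ?_, ?_⟩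
      · have := tag_range (n + 1) X _ hmem
        simp at this
      · have := tag_range (n + 1 + evCount X) Y _ hmem
        simp only at this
        omega
      · rw [Finset.disjoint_left]
        intro e heX heY
        have h1 := tag_range (n + 1) X e heX
        have h2 := tag_range (n + 1 + evCount X) Y e heY
        omega

/-- the tagged label keeps the root step [folklore] -/
theorem rootStep_toGenT (n : ℕ) (P : PGen γ) : (toGenT n P).rootStep = P.rootStep := by
  rw [← PGen.rootStep_toGen, ← gmap_snd_toGenT n P, rootStep_gmap]

/-- the tagged label keeps the reach (windows read through the shape) [folklore] -/
theorem reach_toGenT (W : PEv → ℕ) (n : ℕ) (P : PGen γ) :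
    (toGenT n P).reach (W ∘ Prod.snd) = P.toGen.reach W := by
  rw [← gmap_snd_toGenT n P, reach_gmap]

/-- the shape of the top event: its step is the last step of the history [folklore] -/
theorem snd_top_toGenT : ∀ (n : ℕ) (P : PGen γ), PEv.step (toGenT n P).top.2 = P.lastStep
  | _, .birth _ _ _ => rfl
  | _, .renew _ _ => rfl
  | _, .join _ _ _ => rfl

/-- the events of the tagged label, read through the shape, are events of the canonical label [folklore] -/
theorem snd_mem_toGen_of_mem {n : ℕ} {P : PGen γ} {e : ℕ × PEv} (he : e ∈ (toGenT n P).events) :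
    e.2 ∈ P.toGen.events := by
  rw [← gmap_snd_toGenT n P, events_gmap]
  exact mem_image_of_mem _ he

/-- under the timing discipline every tagged event is dated no later than the last step [folklore] -/
theorem step_le_of_mem_toGenT {K n : ℕ} {P : PGen γ} (hA : P.Adm K) {e : ℕ × PEv} (he : e ∈ (toGenT n P).events) :
    PEv.step e.2 ≤ P.lastStep :=
  HistorySlots.step_le_lastStep_of_mem hA e.2 (snd_mem_toGen_of_mem he)

end Tagged

/-! ## §2 Timing of the tagged label from the geometry -/

section Timing

variable {d L : ℕ} {s R : ℕ → ℕ} (hL : 4 ≤ L) (hdrop : ∀ m, DropCtl s m) (hR : ∀ t, 1 ≤ R t)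
include hL hdrop hR

/-- **THE TAGGED LABEL OF A REALISED HISTORY IS `ConsistentTLE Prod.snd`** (cutoff `K ≥ lastStep`): the flat statement
`HistoryRealise.consistentTLE_toGen_of_realises` transported along `gmap Prod.snd (toGenT n P) = P.toGen`
(`consistentTLE_gmap_iff`). No `TypeNodup`, no timing hypothesis. [folklore] -/
theorem consistentTLE_toGenT_of_realises (C : T4PrintedShapeBanking.Consts) (hn₁ : 13 ≤ C.n₁)
    {P : PGen (Pt d × Finset (Pt d))} {Z : Finset (Pt d)} (hP : Realises L s R P Z) {K : ℕ} (hK : P.lastStep ≤ K)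
    (n : ℕ) : ConsistentTLE Prod.snd C K R (toGenT n P) := by
  rw [← consistentTLE_gmap_iff, gmap_snd_toGenT]
  exact consistentTLE_toGen_of_realises hL hdrop hR C hn₁ P Z hP hK

variable {n₁ : ℕ} (hn₁ : 13 ≤ n₁)
include hn₁

/-- **PENDING ⇒ INSIDE THE BOOKED LIFE, tagged form**: `K < (toGenT n P).reach (dictWT Prod.snd R n₁)`. [folklore] -/
theorem lt_reach_toGenT_of_pendingAt {P : PGen (Pt d × Finset (Pt d))} {Z : Finset (Pt d)} (hP : Realises L s R P Z)
    {K : ℕ} (hK : PendingAt L s R P.lastStep Z K) (n : ℕ) :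
    K < (toGenT n P).reach (dictWT Prod.snd R n₁) := by
  rw [dictWT_eq_comp, reach_toGenT]
  exact lt_reach_of_pendingAt hL hdrop hR hn₁ hP hK

/-- **`Gen.WF` OF THE TAGGED LABEL FROM THE GEOMETRY** — for EVERY realised history (no `TypeNodup`): the
distinctness clauses from the tags (`tag_range`); a renewal after the root birth (`adm_of_realises`) and strictly
inside the booked life (`renew_lt_reach`); a join inside both partners' booked lives (`lt_reach_of_pendingAt`) after
their root births. [folklore] -/
theorem wf_toGenT_of_realises :
    ∀ {P : PGen (Pt d × Finset (Pt d))} {Z : Finset (Pt d)}, Realises L s R P Z →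
      ∀ n : ℕ, (toGenT n P).WF (dictWT Prod.snd R n₁)
  | .birth _ _ _, _, _, _ => trivial
  | .renew G h, Z, hRZ, n => by
      have hlt : h < G.toGen.reach (dictW R n₁) := renew_lt_reach hL hdrop hR hn₁ hRZ
      obtain ⟨ZG, hG, hready, -, -⟩ := hRZ
      have hroot : G.rootStep ≤ G.lastStep := PGen.Adm.rootStep_le_lastStep (adm_of_realises G ZG hG le_rfl)
      have hpos := hready.pos
      have hnot : (n, ((h + 1, 1, 0) : PEv)) ∉ (toGenT (n + 1) G).events := fun hmem => by
        have := tag_range (n + 1) G _ hmem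
        simp at this
      simp only [toGenT, Gen.WF]
      refine ⟨wf_toGenT_of_realises hG (n + 1), hnot, ?_, ?_⟩
      · rw [rootStep_toGenT]; omega
      · rw [dictWT_eq_comp, reach_toGenT]; exact hlt
  | .join X Y sj, Z, hRZ, n => by
      obtain ⟨ZX, ZY, hX, hY, htX, htY, hpX, hpY, -, -⟩ := hRZ
      have hrX : sj < X.toGen.reach (dictW R n₁) := lt_reach_of_pendingAt hL hdrop hR hn₁ hX hpX
      have hrY : sj < Y.toGen.reach (dictW R n₁) := lt_reach_of_pendingAt hL hdrop hR hn₁ hY hpY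
      have hxr : X.rootStep ≤ X.lastStep := PGen.Adm.rootStep_le_lastStep (adm_of_realises X ZX hX le_rfl)
      have hyr : Y.rootStep ≤ Y.lastStep := PGen.Adm.rootStep_le_lastStep (adm_of_realises Y ZY hY le_rfl)
      have hnotX : (n, ((sj, 2, 0) : PEv)) ∉ (toGenT (n + 1) X).events := fun hmem => by
        have := tag_range (n + 1) X _ hmem
        simp at this
      have hnotY : (n, ((sj, 2, 0) : PEv)) ∉ (toGenT (n + 1 + evCount X) Y).events := fun hmem => by
        have := tag_range (n + 1 + evCount X) Y _ hmem
        simp only at this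
        omega
      have hdis : Disjoint (toGenT (n + 1) X).events (toGenT (n + 1 + evCount X) Y).events := by
        rw [Finset.disjoint_left]
        intro e heX heY
        have h1 := tag_range (n + 1) X e heX
        have h2 := tag_range (n + 1 + evCount X) Y e heY
        omega
      simp only [toGenT, Gen.WF]
      refine ⟨wf_toGenT_of_realises hX (n + 1), wf_toGenT_of_realises hY (n + 1 + evCount X), hnotX, hnotY, hdis,
        ?_, ?_⟩
      · rw [rootStep_toGenT, dictWT_eq_comp, reach_toGenT]; omega
      · rw [rootStep_toGenT, dictWT_eq_comp, reach_toGenT]; omega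

end Timing

end

end Summit.QuantumFields.BalabanUV.T4Continuum.SpaceTimePeierls
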